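import Summits.NavierStokesRegularity.NavierStokesRegularity.Theorems.AxisymmetricExtremalityAxisymmetricKatoGlobalStubSeregin2020TypeIILemma22EnergyClassAcrossAxis
import HarnessLib

/-!
# L22-B, piece F3c (1/·): telescoping over a time partition and the `ε → 0` limit — generic tools

Bookkeeping tools for the `S`-passage of the energy class (N–U 2012 §3 (3.9) with Remark 9 for the
class `𝒱` of Seregin 2020 Lemma 2.2; cell ns-inputs, kit `A1-L22B-F3`, route P):

* `telescope_pieces` — summing per-piece real energy inequalities
  `B(m+1) + d m ≤ A m + X m` with junction mismatches `A m ≤ B m + e m`;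
* `sum_setIntegral_Icc_prod_univ`, `sum_setLIntegral_Icc_prod_univ` — additivity of slab
  integrals over consecutive closed time pieces (junction slices are null);
* `energy_limit_of_cut_approximants` — the abstract `ε → 0`, then `σ → 0⁺`, limit turning the
  telescoped inequalities for the cut data into the `EnergyClass` inequality (Fatou enters only
  through the hypothesis `DL ≤ liminf Dₙ`).

Nothing here is a Navier–Stokes statement. [cite: NazarovUraltseva2012, §3 (3.9), Remark 9]
-/

noncomputable section

set_option linter.dupNamespace false

open MeasureTheory Set Function Filter Topology Metric
open scoped NNReal ENNReal

namespace Summit.NavierStokesRegularity.NavierStokesRegularity.Theorems.AxisymmetricKatoGlobal.EulerScaling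

/-- **Telescoping.** If on each piece `m < p` the real energy inequality
`B (m+1) + d m ≤ A m + X m` holds (end mass + dissipation ≤ start mass + sources) and at each
junction the start mass of piece `m` exceeds the reference mass by at most `e m`
(`A m ≤ B m + e m`), then `B p + ∑ d ≤ B 0 + ∑ (X + e)`. [folklore] -/
theorem telescope_pieces (p : ℕ) (A B d X e : ℕ → ℝ)
    (hstep : ∀ m < p, B (m + 1) + d m ≤ A m + X m) (hjunc : ∀ m < p, A m ≤ B m + e m) :
    B p + ∑ m ∈ Finset.range p, d m ≤ B 0 + ∑ m ∈ Finset.range p, (X m + e m) := by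
  induction p with
  | zero => simp
  | succ p ih =>
    have h1 := hstep p (Nat.lt_succ_self p)
    have h2 := hjunc p (Nat.lt_succ_self p)
    have ih' := ih (fun m hm => hstep m (Nat.lt_succ_of_lt hm))
      (fun m hm => hjunc m (Nat.lt_succ_of_lt hm))
    rw [Finset.sum_range_succ, Finset.sum_range_succ]
    linarith

/-- `∫_{[a,b] × ℝ³} f = ∫_{]a,b] × ℝ³} f`: the slice `{a} × ℝ³` is null. [folklore] -/
theorem setIntegral_Icc_prod_univ_eq_Ioc (a b : ℝ) (f : ℝ × EuclideanSpace ℝ (Fin 3) → ℝ) :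
    ∫ z in Icc a b ×ˢ (univ : Set (EuclideanSpace ℝ (Fin 3))), f z =
      ∫ z in Ioc a b ×ˢ (univ : Set (EuclideanSpace ℝ (Fin 3))), f z := by
  rw [restrict_Icc_prod_univ_eq_restrict_Ioc_prod, restrict_Ioc_prod_volume_eq]

/-- `∫⁻_{[a,b] × ℝ³} f = ∫⁻_{]a,b] × ℝ³} f`: the slice `{a} × ℝ³` is null. [folklore] -/
theorem setLIntegral_Icc_prod_univ_eq_Ioc (a b : ℝ) (f : ℝ × EuclideanSpace ℝ (Fin 3) → ℝ≥0∞) :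
    ∫⁻ z in Icc a b ×ˢ (univ : Set (EuclideanSpace ℝ (Fin 3))), f z =
      ∫⁻ z in Ioc a b ×ˢ (univ : Set (EuclideanSpace ℝ (Fin 3))), f z := by
  rw [restrict_Icc_prod_univ_eq_restrict_Ioc_prod, restrict_Ioc_prod_volume_eq]

/-- **Additivity of slab integrals over consecutive time pieces** (Bochner): for
`τ 0 ≤ τ 1 ≤ ⋯ ≤ τ p` and `f` integrable on `[τ 0, τ p] × ℝ³`,
`∑_{m<p} ∫_{[τ m, τ (m+1)] × ℝ³} f = ∫_{[τ 0, τ p] × ℝ³} f`. [folklore] -/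
theorem sum_setIntegral_Icc_prod_univ (p : ℕ) (τ : ℕ → ℝ) (hτ : ∀ m < p, τ m ≤ τ (m + 1))
    {f : ℝ × EuclideanSpace ℝ (Fin 3) → ℝ}
    (hf : IntegrableOn f (Icc (τ 0) (τ p) ×ˢ (univ : Set (EuclideanSpace ℝ (Fin 3)))) volume) :
    ∑ m ∈ Finset.range p, ∫ z in Icc (τ m) (τ (m + 1)) ×ˢ (univ : Set (EuclideanSpace ℝ (Fin 3))), f z =
      ∫ z in Icc (τ 0) (τ p) ×ˢ (univ : Set (EuclideanSpace ℝ (Fin 3))), f z := by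
  induction p with
  | zero =>
    rw [Finset.sum_range_zero, setIntegral_Icc_prod_univ_eq_Ioc, Ioc_self, empty_prod,
      Measure.restrict_empty, integral_zero_measure]
  | succ p ih =>
    have hτ' : ∀ m < p, τ m ≤ τ (m + 1) := fun m hm => hτ m (Nat.lt_succ_of_lt hm)
    have hmono : τ 0 ≤ τ p := by
      clear ih hf hτ
      induction p with
      | zero => exact le_rfl
      | succ q iq => exact (iq fun m hm => hτ' m (Nat.lt_succ_of_lt hm)).trans (hτ' q (Nat.lt_succ_self q))
    have hlast : τ p ≤ τ (p + 1) := hτ p (Nat.lt_succ_self p)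
    have hf' : IntegrableOn f (Icc (τ 0) (τ p) ×ˢ (univ : Set (EuclideanSpace ℝ (Fin 3)))) volume :=
      hf.mono_set (prod_mono (Icc_subset_Icc_right hlast) Subset.rfl)
    rw [Finset.sum_range_succ, ih hτ' hf', setIntegral_Icc_prod_univ_eq_Ioc, setIntegral_Icc_prod_univ_eq_Ioc,
      setIntegral_Icc_prod_univ_eq_Ioc, ← Ioc_union_Ioc_eq_Ioc hmono hlast, union_prod,
      setIntegral_union]
    · exact (Set.disjoint_prod.2 (Or.inl (Ioc_disjoint_Ioc_of_le le_rfl)))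
    · exact measurableSet_Ioc.prod MeasurableSet.univ
    · exact hf.mono_set (prod_mono (Ioc_subset_Icc_self.trans (Icc_subset_Icc_right hlast)) Subset.rfl)
    · exact hf.mono_set (prod_mono (Ioc_subset_Icc_self.trans (Icc_subset_Icc_left hmono)) Subset.rfl)

/-- **Additivity of slab `lintegral`s over consecutive time pieces**: for `τ 0 ≤ ⋯ ≤ τ p` and any
`f ≥ 0`, `∑_{m<p} ∫⁻_{[τ m, τ (m+1)] × ℝ³} f = ∫⁻_{[τ 0, τ p] × ℝ³} f`. [folklore] -/
theorem sum_setLIntegral_Icc_prod_univ (p : ℕ) (τ : ℕ → ℝ) (hτ : ∀ m < p, τ m ≤ τ (m + 1))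
    (f : ℝ × EuclideanSpace ℝ (Fin 3) → ℝ≥0∞) :
    ∑ m ∈ Finset.range p, ∫⁻ z in Icc (τ m) (τ (m + 1)) ×ˢ (univ : Set (EuclideanSpace ℝ (Fin 3))), f z =
      ∫⁻ z in Icc (τ 0) (τ p) ×ˢ (univ : Set (EuclideanSpace ℝ (Fin 3))), f z := by
  induction p with
  | zero =>
    rw [Finset.sum_range_zero, setLIntegral_Icc_prod_univ_eq_Ioc, Ioc_self, empty_prod,
      Measure.restrict_empty, lintegral_zero_measure]
  | succ p ih =>
    have hτ' : ∀ m < p, τ m ≤ τ (m + 1) := fun m hm => hτ m (Nat.lt_succ_of_lt hm)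
    have hmono : τ 0 ≤ τ p := by
      clear ih hτ
      induction p with
      | zero => exact le_rfl
      | succ q iq => exact (iq fun m hm => hτ' m (Nat.lt_succ_of_lt hm)).trans (hτ' q (Nat.lt_succ_self q))
    have hlast : τ p ≤ τ (p + 1) := hτ p (Nat.lt_succ_self p)
    rw [Finset.sum_range_succ, ih hτ', setLIntegral_Icc_prod_univ_eq_Ioc, setLIntegral_Icc_prod_univ_eq_Ioc,
      setLIntegral_Icc_prod_univ_eq_Ioc, ← Ioc_union_Ioc_eq_Ioc hmono hlast, union_prod,
      lintegral_union (measurableSet_Ioc.prod MeasurableSet.univ)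
        (Set.disjoint_prod.2 (Or.inl (Ioc_disjoint_Ioc_of_le le_rfl)))]

/-- **The `ε → 0` limit of the telescoped inequalities (abstract form).** Suppose for every
`n` (cover of total radius `→ 0`) and every splitting parameter `σ > 0` the telescoped real
inequality `A + Dₙ ≤ B + (1+σ)P₁ + I₂(n) + I₃(n) + P₄ + (1+σ⁻¹)E₁(n) + E(n)` holds with finite
cut dissipations `Dₙ`, where `I₂(n) → P₂`, `I₃(n) → P₃` (dominated convergence of the cut drift and
axis terms), `E₁(n), E(n) → 0` (excision errors), and the true dissipation satisfies Fatou's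
`DL ≤ liminf Dₙ`. Then `A + DL ≤ B + P₁ + P₂ + P₃ + P₄` in the `ℝ≥0∞` form of `EnergyClass`.
[cite: NazarovUraltseva2012, §3 Remark 9] -/
theorem energy_limit_of_cut_approximants {A B P₁ P₂ P₃ P₄ : ℝ} {DL : ℝ≥0∞} {D : ℕ → ℝ≥0∞}
    {I₂ I₃ E₁ E : ℕ → ℝ} (hA : 0 ≤ A) (hDL : DL ≤ Filter.liminf D atTop) (hD : ∀ n, D n ≠ ⊤)
    (hI₂ : Tendsto I₂ atTop (𝓝 P₂)) (hI₃ : Tendsto I₃ atTop (𝓝 P₃))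
    (hE₁ : Tendsto E₁ atTop (𝓝 0)) (hE : Tendsto E atTop (𝓝 0))
    (hineq : ∀ n, ∀ σ : ℝ, 0 < σ →
      A + (D n).toReal ≤ B + (1 + σ) * P₁ + I₂ n + I₃ n + P₄ + (1 + σ⁻¹) * E₁ n + E n) :
    ENNReal.ofReal A + DL ≤ ENNReal.ofReal (B + P₁ + P₂ + P₃ + P₄) := by
  set R0 : ℝ := B + P₁ + P₂ + P₃ + P₄ with hR0
  -- ### step 1: for each `σ > 0`, `DL` is finite and `A + DL.toReal ≤ R0 + σ P₁`
  have hσ : ∀ σ : ℝ, 0 < σ → DL ≠ ⊤ ∧ A + DL.toReal ≤ R0 + σ * P₁ := by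
    intro σ hσ
    set b : ℕ → ℝ := fun n => B + (1 + σ) * P₁ + I₂ n + I₃ n + P₄ + (1 + σ⁻¹) * E₁ n + E n - A with hb
    have hb_tend : Tendsto b atTop (𝓝 (B + (1 + σ) * P₁ + P₂ + P₃ + P₄ + (1 + σ⁻¹) * 0 + 0 - A)) := by
      have h1 : Tendsto (fun n => B + (1 + σ) * P₁ + I₂ n) atTop (𝓝 (B + (1 + σ) * P₁ + P₂)) :=
        tendsto_const_nhds.add hI₂
      exact ((((h1.add hI₃).add tendsto_const_nhds).add (tendsto_const_nhds.mul hE₁)).add hE).sub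
        tendsto_const_nhds
    have hDb : ∀ n, D n ≤ ENNReal.ofReal (b n) := by
      intro n
      have h := hineq n σ hσ
      have hb0 : (D n).toReal ≤ b n := by rw [hb]; linarith
      exact (ENNReal.le_ofReal_iff_toReal_le (hD n) (ENNReal.toReal_nonneg.trans hb0)).2 hb0
    have hlim : Filter.liminf D atTop ≤ ENNReal.ofReal (B + (1 + σ) * P₁ + P₂ + P₃ + P₄ + (1 + σ⁻¹) * 0 + 0 - A) := by
      rw [← ((ENNReal.continuous_ofReal.tendsto _).comp hb_tend).liminf_eq]
      exact Filter.liminf_le_liminf (Eventually.of_forall hDb)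
    have hDLle := hDL.trans hlim
    have hfin : DL ≠ ⊤ := ne_top_of_le_ne_top ENNReal.ofReal_ne_top hDLle
    have hnn : 0 ≤ B + (1 + σ) * P₁ + P₂ + P₃ + P₄ + (1 + σ⁻¹) * 0 + 0 - A :=
      ge_of_tendsto' hb_tend fun n => ENNReal.toReal_nonneg.trans (by
        have h := hineq n σ hσ; rw [hb]; linarith)
    refine ⟨hfin, ?_⟩
    have := (ENNReal.le_ofReal_iff_toReal_le hfin hnn).1 hDLle
    rw [hR0]; linarith
  obtain ⟨hfin, -⟩ := hσ 1 one_pos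
  -- ### step 2: `σ → 0⁺`
  have hmain : A + DL.toReal ≤ R0 := by
    by_cases hP : P₁ ≤ 0
    · have := (hσ 1 one_pos).2; linarith
    · push Not at hP
      refine le_of_forall_pos_le_add fun δ hδ => ?_
      have := (hσ (δ / P₁) (div_pos hδ hP)).2
      rwa [div_mul_cancel₀ _ hP.ne'] at this
  calc ENNReal.ofReal A + DL = ENNReal.ofReal A + ENNReal.ofReal DL.toReal := by rw [ENNReal.ofReal_toReal hfin]
    _ = ENNReal.ofReal (A + DL.toReal) := (ENNReal.ofReal_add hA ENNReal.toReal_nonneg).symm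
    _ ≤ ENNReal.ofReal R0 := ENNReal.ofReal_le_ofReal hmain

end Summit.NavierStokesRegularity.NavierStokesRegularity.Theorems.AxisymmetricKatoGlobal.EulerScaling

end
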